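import Mathlib
import Summits.NavierStokesRegularity.NavierStokesRegularity.Theses.TaoLadderRungTwoFlat
import Summits.NavierStokesRegularity.NavierStokesRegularity.Theorems.TaoLadderRungTwoFlatMirrorTableDefs
import Summits.NavierStokesRegularity.NavierStokesRegularity.Theorems.TaoLadderRungTwoFlatSplitLayerDefs
import HarnessLib

/-!
# The glue of the two-layer split of K_A♭ (SPLIT-T48): `FlatGapOfMirrorLayer`
  (closes item stmt-NavierStokesRegularity-23910 of route TaoLadderRungTwoFlat; cell harvest/h2-tao-ladder, p1 g21;
  proof of record = theory-1 g36/g37 `flatGapCertificatesV2_of_split48`, numT48/SplitPreview48.lean 55a26067d7d2afb1 /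
  numT49/SplitPreview48T.lean 97f55d6c02a49351)

`FlatGapOfMirrorLayer : MirrorSolitaryWave → GradedAdiabaticWake → FlatGapCertificatesV2` — instantiate the transfer
theorem (child 2, stmt-…-23909) at `ε = 1/2`, `X₀ = MirrorPulse.datumE3 = (1,2)`, `i₀ = 0` (carrier) with child 1's
(stmt-…-23908) pulse `(τ, Φ)` and geometric gauge data `(g, b, ρ, C, N)`; table-class constant `C = 4` by
`inTableClassOn_mirrorTable_half`; `εs := min εs (1/2)`.

HONEST FRAMING: a 12-line composition of two OPEN hypotheses about a MODEL lattice (Tao 2016 §4 vocabulary on `S♭`);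
closing the glue item certifies nothing (both children remain open); nothing about the Navier–Stokes equations.
-/

noncomputable section

-- the sub-problem namespace repeats the summit name by design (D-0017)
set_option linter.dupNamespace false

namespace Summit.NavierStokesRegularity.NavierStokesRegularity.Theorems

open Summit.NavierStokesRegularity.NavierStokesRegularity.Theses.TaoLadderRungTwoFlat

/-- **SPLIT-T48 glue**: child 1 (`MirrorSolitaryWave`, the λ₀ = 1 certificate target at the charged datum) and child 2
(`GradedAdiabaticWake`, the ε₀-uniform transfer theorem) together give K_A♭ = `FlatGapCertificatesV2` with `C = 4`,
`m = 2`, `α = mirrorTable ½ ½`, `X₀ = datumE3`, `i₀ = 0`. [cite: Tao2016AveragedNS, §5–§6 (the cascade certificate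
format); route TaoLadderRungTwoFlat, glue item FlatGapOfMirrorLayer (theory-1 g36 SPLIT-T48)] -/
theorem taoLadderRungTwoFlat_flatGapOfMirrorLayer_proof : FlatGapOfMirrorLayer := by
  unfold FlatGapOfMirrorLayer
  rintro ⟨τ, Φ, g, b, ρ, C, N, hg, hb, hP, hR, hvac, hS2, hS3⟩ h₂
  have hX : MirrorPulse.datumE3 0 ≠ 0 := by
    simp [MirrorPulse.datumE3]
  obtain ⟨εs, hεs, hall⟩ :=
    h₂ (1 / 2) _ 0 τ Φ g b ρ C N (by norm_num) (by norm_num) hX hg hb hP hR hvac hS2 hS3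
  refine ⟨4, by norm_num, min εs (1 / 2), lt_min hεs (by norm_num),
    (min_le_right _ _).trans_lt (by norm_num), ?_⟩
  intro ε₀ h0 hle
  obtain ⟨σ, Z, w, r, ρ', θ₀, θ, c₀, c, env₀, hgap, hthin⟩ := hall ε₀ h0 (hle.trans (min_le_left _ _))
  exact ⟨2, σ, 0, _, _, Z, w, r, ρ', θ₀, θ, c₀, c, env₀, inTableClassOn_mirrorTable_half, hX, hgap, hthin⟩

end Summit.NavierStokesRegularity.NavierStokesRegularity.Theorems

end
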